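import Summits.AnomalousDissipation.AnomalousDissipation.Theorems.BaireTransferRobustLoudUpgradeLineLeaf
import Summits.AnomalousDissipation.AnomalousDissipation.Theorems.BaireTransferRobustLoudUpgradeStubSteadyWindow
import Summits.AnomalousDissipation.AnomalousDissipation.Theorems.BaireTransferRobustLoudUpgradeStubSteadyPersist
import Summits.AnomalousDissipation.AnomalousDissipation.Theorems.BaireTransferRobustLoudUpgradeStubLeafSteadySmallExists
import Summits.AnomalousDissipation.AnomalousDissipation.Theorems.BaireTransferRobustLoudUpgradeStubSmallFlowNondeg
import Summits.AnomalousDissipation.AnomalousDissipation.Theorems.BaireTransferRobustLoudUpgradeStubPeriodicIsSteady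

/-!
# The laminar corner of the crux `BaireTransfer.RobustLoudUpgrade` (stmt-AnomalousDissipation-1144) for PERIODIC
# witnesses of ANY mean — assembly (companion lead c1 of the line `malkin-cone-group-orbits`)

Registered sub-goals proved here: `laminarPeriodic_steady`, `loud_laminar_subset_tameLeaf`.

Below the leaf-uniqueness Grashof number (`‖f_c‖₂ ≤ κ ν²`) every `τ`-periodic classical solution of `NS_ν(f_c)` on
`ℝ × T³`, of any spatial mean `m`, is constant in time and equal to the small classical steady state of its conserved-mean
leaf, which is leaf-nondegenerate; hence a loud force with such a witness lies in `nondegSteadyLeaf ⊆ tameLeaf` itself at the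
relaxed budgets `(2E, ε/2)` (Temam 1979 Ch. II §1 in a leaf; Serrin 1959 / Temam 1979 Ch. III §3.4).  The three analytic
inputs are the landed stubs `stub_leafSteadySmallExists` (small-data steady state of prescribed mean with `H²`/`H¹`
smallness), `stub_smallFlowNondeg` (`‖Δv‖₂ ≤ κν ⇒ ¬ IsLinNSEigenvalue ν v 0`) and `stub_periodicIsSteady` (periodic +
small steady state with the same mean ⇒ equal); this file adds mean conservation and the bookkeeping.  Pure proof file.
-/

-- `Summit.<Summit>.<Problem>` is the tree's mandated summit-side namespace (CONVENTIONS §2); for this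
-- single-conjunct summit the two coincide, so the duplicate is deliberate.
set_option linter.dupNamespace false

noncomputable section

open scoped BigOperators Topology
open Filter Set Function TopologicalSpace MeasureTheory

namespace Summit.AnomalousDissipation.AnomalousDissipation.Theorems.RobustLoudUpgrade.LaminarCorner

open Literature.Analysis.FunctionSpaces Literature.Analysis.FunctionSpaces.Torus
open Literature.Analysis.FluidPDE
open Summit.AnomalousDissipation.AnomalousDissipation.Theses.BaireTransfer
open Summit.AnomalousDissipation.AnomalousDissipation.Theorems.RobustLoudUpgrade

/-! ## §2 Assembly (lead c1): laminar periodic witnesses of any mean ARE leaf-nondegenerate steady states -/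

/-- The squared gradient norm of the zero field vanishes. [folklore] -/
theorem gradNormSq_zero : gradNormSq (0 : UnitAddTorus (Fin 3) → EuclideanSpace ℝ (Fin 3)) = 0 := by
  simp [gradNormSq, Torus.partialDeriv, Torus.lineDeriv]

/-- **Spatial means of a classical Navier–Stokes solution on `ℝ × T³` with a mean-zero force are conserved**:
`d/dt ∫ u(t) = ∫ (νΔu − (u·∇)u − ∇p + f) = 0` (each integral vanishes on the torus). [folklore] -/
theorem integral_velocity_eq {ν : ℝ} {f : UnitAddTorus (Fin 3) → EuclideanSpace ℝ (Fin 3)}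
    {u : ℝ → UnitAddTorus (Fin 3) → EuclideanSpace ℝ (Fin 3)} {p : ℝ → UnitAddTorus (Fin 3) → ℝ}
    (h : IsClassicalNSSolutionOn Set.univ ν (fun _ => f) u p) (hf : HasZeroMean f) (t : ℝ) :
    (∫ x, u t x) = ∫ x, u 0 x := by
  -- the mean has derivative `∫ ∂ₜu = 0` at every time
  have hderiv : ∀ s : ℝ, HasDerivAt (fun r => ∫ x, u r x) 0 s := by
    intro s
    have hs : s ∈ (Set.univ : Set ℝ) := Set.mem_univ s
    have hd := h.smooth_velocity.hasDerivWithinAt_integral convex_univ hs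
    rw [hasDerivWithinAt_univ] at hd
    have hus : IsSmooth (u s) := h.smooth_velocity.isSmooth_slice hs
    have hps : IsSmooth (p s) := h.smooth_pressure.isSmooth_slice hs
    have hsmf : IsSmooth f := by
      -- the force is the residual of the momentum equation at `t = s`: `f = ∂ₜu + (u·∇)u − νΔu + ∇p`, a sum of smooth slices
      have hmom := h.momentum s hs
      have e : f = fun x => Torus.timeDerivWithin Set.univ u s x + convect (u s) (u s) x - ν • laplacian (u s) x +
          Torus.gradient (p s) x := by
        funext x
        have h1 := hmom x
        rw [h1]
        abel
      rw [e]
      exact (((h.smooth_velocity.isSmooth_timeDerivWithin uniqueDiffOn_univ hs).add (hus.convect hus)).sub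
        (hus.laplacian.smul ν)).add hps.gradient
    have hval : (∫ x, Torus.timeDerivWithin Set.univ u s x) = 0 := by
      have e : (fun x => Torus.timeDerivWithin Set.univ u s x) =
          fun x => ν • laplacian (u s) x - Torus.gradient (p s) x + f x - convect (u s) (u s) x := by
        funext x
        have h1 := h.momentum s hs x
        rw [eq_sub_of_add_eq h1]
      rw [e, integral_sub, integral_add, integral_sub, integral_smul, integral_laplacian_eq_zero_of_isSmooth hus,
        integral_gradient_eq_zero hps, integral_convect_self_eq_zero hus (h.divFree s hs)]
      · rw [show (∫ x, f x) = 0 from hf]; simp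
      · exact (hus.laplacian.smul ν).integrable
      · exact hps.gradient.integrable
      · exact ((hus.laplacian.smul ν).sub hps.gradient).integrable
      · exact hsmf.integrable
      · exact (((hus.laplacian.smul ν).sub hps.gradient).add hsmf).integrable
      · exact (hus.convect hus).integrable
    rwa [hval] at hd
  have hdiff : Differentiable ℝ fun r => ∫ x, u r x := fun s => (hderiv s).differentiableAt
  exact is_const_of_deriv_eq_zero hdiff (fun s => (hderiv s).deriv) t 0

/-- **Laminar periodic witnesses are steady and leaf-nondegenerate** (assembly of the three stubs): there is `κ > 0`
such that every `τ`-periodic classical solution `u` of `NS_ν(f_c)` on `ℝ × T³`, `ν > 0`, of ANY mean, with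
`‖f_c‖₂ ≤ κ ν²`, is constant in time, equal to a classical steady state `v` of `NS_ν(f_c)` whose linearisation has
no mean-zero classical kernel. [folklore] -/
theorem laminarPeriodic_steady :
    ∃ κ : ℝ, 0 < κ ∧ ∀ (S : Finset (Fin 3 → ℤ)) (c : Coeff S) (ν τ : ℝ)
      (u : ℝ → UnitAddTorus (Fin 3) → EuclideanSpace ℝ (Fin 3)) (p : ℝ → UnitAddTorus (Fin 3) → ℝ),
      0 < ν → 0 < τ → IsClassicalNSSolutionOn Set.univ ν (fun _ => force S c) u p → Function.Periodic u τ →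
      Real.sqrt (∫ x, ‖force S c x‖ ^ 2) ≤ κ * ν ^ 2 →
      ∃ (v : UnitAddTorus (Fin 3) → EuclideanSpace ℝ (Fin 3)) (q : UnitAddTorus (Fin 3) → ℝ),
        Torus.IsSteadyNSState ν (force S c) v q ∧ ¬ Torus.IsLinNSEigenvalue ν v 0 ∧ ∀ t, u t = v := by
  obtain ⟨κ₁, hκ₁, h₁⟩ := stub_leafSteadySmallExists
  obtain ⟨κ₂, hκ₂, h₂⟩ := stub_smallFlowNondeg
  obtain ⟨κ₃, hκ₃, h₃⟩ := stub_periodicIsSteady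
  refine ⟨min κ₁ (min (κ₂ / 2) κ₃), lt_min hκ₁ (lt_min (half_pos hκ₂) hκ₃), ?_⟩
  intro S c ν τ u p hν hτ hsol hper hsmall
  set F : ℝ := Real.sqrt (∫ x, ‖force S c x‖ ^ 2) with hF
  have hFsq : F ^ 2 = ∫ x, ‖force S c x‖ ^ 2 := Real.sq_sqrt (integral_nonneg fun _ => sq_nonneg _)
  have hk₁ : F ≤ κ₁ * ν ^ 2 := hsmall.trans (mul_le_mul_of_nonneg_right (min_le_left _ _) (sq_nonneg ν))
  have hk₂ : F ≤ κ₂ / 2 * ν ^ 2 :=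
    hsmall.trans (mul_le_mul_of_nonneg_right ((min_le_right _ _).trans (min_le_left _ _)) (sq_nonneg ν))
  have hk₃ : F ≤ κ₃ * ν ^ 2 :=
    hsmall.trans (mul_le_mul_of_nonneg_right ((min_le_right _ _).trans (min_le_right _ _)) (sq_nonneg ν))
  -- the small steady state in the witness's leaf
  obtain ⟨v, q, hst, hmean, hlap, hgrad⟩ := h₁ S c ν (∫ x, u 0 x) hν hk₁
  have hvs : IsSmooth v := hst.smooth_velocity.isSmooth_slice (Set.mem_univ (0 : ℝ))
  have hvd : IsDivFree v := hst.divFree 0 (Set.mem_univ (0 : ℝ))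
  -- it is leaf-nondegenerate
  have hnd : ¬ Torus.IsLinNSEigenvalue ν v 0 := by
    refine h₂ ν v hν hvs hvd ?_
    have h1 : Real.sqrt (∫ x, ‖laplacian v x‖ ^ 2) ≤ 2 * F / ν := by
      rw [Real.sqrt_le_left (by positivity)]
      rw [div_pow, mul_pow, hFsq]
      have : (2 : ℝ) ^ 2 * (∫ x, ‖force S c x‖ ^ 2) / ν ^ 2 = 4 * (∫ x, ‖force S c x‖ ^ 2) / ν ^ 2 := by norm_num
      rw [this]; exact hlap
    calc Real.sqrt (∫ x, ‖laplacian v x‖ ^ 2) ≤ 2 * F / ν := h1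
      _ ≤ 2 * (κ₂ / 2 * ν ^ 2) / ν := by gcongr
      _ = κ₂ * ν := by field_simp
  -- the witness has the conserved mean of `v`, hence IS `v`
  have hmeans : ∀ t, (∫ x, u t x) = ∫ x, v x := fun t => by
    rw [hmean]; exact integral_velocity_eq hsol (SteadyPersist.hasZeroMean_force' c) t
  have huv : ∀ t, u t = v := by
    refine h₃ ν τ (force S c) u p v q hν hτ hsol hper hst hmeans ?_
    have h1 : Real.sqrt (gradNormSq v) ≤ F / ν := by
      rw [Real.sqrt_le_left (by positivity), div_pow, hFsq]
      exact hgrad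
    calc Real.sqrt (gradNormSq v) ≤ F / ν := h1
      _ ≤ κ₃ * ν ^ 2 / ν := by gcongr
      _ = κ₃ * ν := by field_simp
  exact ⟨v, q, hst, hnd, huv⟩

/-- **The laminar complement of the residual**: a loud force with a laminar witness is tame itself — it lies in
`nondegSteadyLeaf ⊆ tameLeaf` at the relaxed budgets `(2E, ε/2)` (indeed at every `E' > ⟨‖u‖²⟩`, `ε' < ⟨ν‖∇u‖²⟩`).
[folklore] -/
theorem loud_laminar_subset_tameLeaf :
    ∃ κ : ℝ, 0 < κ ∧ ∀ (S : Finset (Fin 3 → ℤ)) (a E ε : ℝ) (c : Coeff S) (ν τ : ℝ)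
      (u : ℝ → UnitAddTorus (Fin 3) → EuclideanSpace ℝ (Fin 3)) (p : ℝ → UnitAddTorus (Fin 3) → ℝ),
      0 < ε → 0 < ν → ν < a → 0 < τ → IsClassicalNSSolutionOn Set.univ ν (fun _ => force S c) u p →
      Function.Periodic u τ → meanEnergy u ≤ E → ε ≤ meanDissipation ν u →
      Real.sqrt (∫ x, ‖force S c x‖ ^ 2) ≤ κ * ν ^ 2 → c ∈ tameLeaf S a (2 * E) (ε / 2) := by
  obtain ⟨κ, hκ, h⟩ := laminarPeriodic_steady
  refine ⟨κ, hκ, fun S a E ε c ν τ u p hε hν hνa hτ hsol hper hE hε' hsmall => ?_⟩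
  obtain ⟨v, q, hst, hnd, huv⟩ := h S c ν τ u p hν hτ hsol hper hsmall
  have hvs : IsSmooth v := hst.smooth_velocity.isSmooth_slice (Set.mem_univ (0 : ℝ))
  have hu : u = fun _ => v := funext huv
  rw [hu, SteadyWindow.meanEnergy_const] at hE
  rw [hu, SteadyWindow.meanDissipation_const ν hvs] at hε'
  -- positive dissipation forces `v ≠ 0`, hence positive energy, hence `0 < E`
  have hE0 : 0 < E := by
    have hG : 0 < gradNormSq v := by
      by_contra hG
      have : ν * gradNormSq v ≤ 0 := mul_nonpos_of_nonneg_of_nonpos hν.le (le_of_not_gt hG)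
      linarith
    have hv0 : v ≠ 0 := by
      rintro rfl
      rw [gradNormSq_zero] at hG
      exact lt_irrefl _ hG
    have hint : 0 < ∫ x, ‖v x‖ ^ 2 := by
      by_contra hle
      exact hv0 (eq_zero_of_integral_norm_sq_nonpos hvs (le_of_not_gt hle))
    linarith
  refine Or.inl (Or.inl (Or.inl (Or.inl (Or.inl ⟨ν, hν, hνa, v, q, hst, ?_, ?_, hnd⟩))))
  · rw [SteadyWindow.meanEnergy_const]; linarith
  · rw [SteadyWindow.meanDissipation_const ν hvs]; linarith

end Summit.AnomalousDissipation.AnomalousDissipation.Theorems.RobustLoudUpgrade.LaminarCorner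

end
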